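import Summits.Ventures.HodgeRepro2.KleinFourProjectors
import Summits.Ventures.HodgeRepro2.HodgePeriodHeckeEigen
import Summits.Ventures.HodgeRepro2.DoubleCosetMem

/-!
# KleinFourPeriodSelection — the (N)-period against a SIGN-DEFINITE partner only sees the same-sign component of
the vertex form (p2 annex row 171)

Cell pub-hodge-repro2, Tier 5 kernel annex (seat p2, Shimura-data / Hecke side). One definition (`projForm`), the
rest proof lane.
§8(d): uses an L-value-free non-vanishing device: NO.

Generic part (`…HodgeRepro2.CommutingInvolutions`, Mathlib only): for two self-adjoint operators `T₀, T₁` of a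
complex inner product space (no commutation needed here) and `g` with `T_i g = ε_i g`, `ε_i = ±1`:
`⟪g, P_{ε₀ε₁} v⟫ = ⟪g, v⟫` for every `v` (`inner_proj_eq_of_signs`) — the other three components of `v` are
orthogonal to `g`.
Application (`…ShimuraData`), on the compact-quotient Petersson space of `Γ_N` of a coordinate lattice for the
record's Picard form `H_a = diag(1,1,a)` (rows 168–170): the Hecke operators `T_{w₀}, T_{w₁}` of the coordinate sign
changes are self-adjoint (`w_i² = 1` ⇒ `w_i⁻¹ ∈ Γ_N w_i Γ_N`, rows 139 / 122; stated for ANY two involutions of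
`U(H)(K)` on ANY compact-quotient `S`), so for a weight-3 form `g` with
signs `(ε₀, ε₁)` and EVERY weight-3 form `f`:
`∫_D ω_f ∧ conj ω_g = ∫_D ω_{P_ε f} ∧ conj ω_g` (`setIntegral_hodgeWedge_eq_projForm_of_signs`), where
`P_ε f = ¼ (f + ε₀ T_{w₀} f + ε₁ T_{w₁} f + ε₀ε₁ T_{w₀} T_{w₁} f)` is the sign component of `f` (`projForm`,
`mk_projForm`). Combined with row 169's basis: the (N)-period pairing of the vertex form against a sign-definite
eigenform is computed on the vertex form's component of the SAME signs.

No `sorry`; `#print axioms` ⊆ {propext, Classical.choice, Quot.sound}.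
-/

namespace Summit.Ventures.HodgeRepro2.CommutingInvolutions

variable {V : Type*} [NormedAddCommGroup V] [InnerProductSpace ℂ V] {T₀ T₁ : V →ₗ[ℂ] V}

/-- For self-adjoint `T₀, T₁` and `g` with signs `(ε₀, ε₁) ∈ {±1}²`: `⟪g, P_{ε₀ε₁} v⟫ = ⟪g, v⟫`. -/
theorem inner_proj_eq_of_signs (hs0 : ∀ x y, inner ℂ (T₀ x) y = inner ℂ x (T₀ y))
    (hs1 : ∀ x y, inner ℂ (T₁ x) y = inner ℂ x (T₁ y))
    {g : V} {ε₀ ε₁ : ℂ} (hε0 : ε₀ = 1 ∨ ε₀ = -1) (hε1 : ε₁ = 1 ∨ ε₁ = -1)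
    (hg0 : T₀ g = ε₀ • g) (hg1 : T₁ g = ε₁ • g) (v : V) :
    inner ℂ g (proj T₀ T₁ ε₀ ε₁ v) = inner ℂ g v := by
  have hconj0 : (starRingEnd ℂ) ε₀ = ε₀ := by rcases hε0 with h | h <;> simp [h]
  have hconj1 : (starRingEnd ℂ) ε₁ = ε₁ := by rcases hε1 with h | h <;> simp [h]
  have hsq0 : ε₀ * ε₀ = 1 := by rcases hε0 with h | h <;> simp [h]
  have hsq1 : ε₁ * ε₁ = 1 := by rcases hε1 with h | h <;> simp [h]
  have h10 : inner ℂ g (T₀ v) = ε₀ * inner ℂ g v := by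
    rw [← hs0, hg0, inner_smul_left, hconj0]
  have h11 : inner ℂ g (T₁ v) = ε₁ * inner ℂ g v := by
    rw [← hs1, hg1, inner_smul_left, hconj1]
  have h01 : inner ℂ g (T₀ (T₁ v)) = ε₀ * (ε₁ * inner ℂ g v) := by
    rw [← hs0, hg0, inner_smul_left, hconj0, h11]
  simp only [proj, inner_smul_right, inner_add_right, h10, h11, h01]
  linear_combination (norm := ring_nf) ((4 : ℂ)⁻¹ * inner ℂ g v) * hsq0 + ((4 : ℂ)⁻¹ * inner ℂ g v) * hsq1 +
    ((4 : ℂ)⁻¹ * inner ℂ g v * ε₁ * ε₁) * hsq0 + ((4 : ℂ)⁻¹ * inner ℂ g v) * hsq1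

end Summit.Ventures.HodgeRepro2.CommutingInvolutions

namespace Summit.Ventures.HodgeRepro2.ShimuraData

open Summit.Ventures.HodgeRepro2.CommutingInvolutions

variable {K : Type*} [Field K] [NumberField K] [NumberField.IsCMField K]
  {τ₁ : K →+* ℂ} {H : Matrix (Fin 3) (Fin 3) K} {Q : Matrix (Fin 3) (Fin 3) ℂ}

section General

variable (hQ : IsFrame K τ₁ H Q) (S : Subgroup (GL (Fin 3) K)) (hS : (S : Set (GL (Fin 3) K)) ⊆ unitaryGroup K H)
  [CompactSpace (ballQuotient hQ S hS)] {D : Set ball₂} (k : ℕ) (hD : IsBallFundamentalDomain hQ S hS D)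
  (hDm : MeasurableSet D)
  (inst : ∀ δ : unitaryGroup K H, Fintype (S ⧸ (heckeSubgroup S (δ : GL (Fin 3) K)).subgroupOf S))

/-- An involution `δ ∈ U(H)(K)` gives a SELF-ADJOINT Hecke operator on the Petersson space
(`δ⁻¹ = δ ∈ SδS`, rows 139 / 122). -/
theorem inner_heckeFamilyOf_eq_of_mul_self_eq_one {δ : unitaryGroup K H} (hδ : (δ : GL (Fin 3) K) * δ = 1)
    (x y : PeterssonSpace hQ S hS k hD) :
    inner ℂ (heckeFamilyOf hQ S hS k hD hDm inst δ x) y = inner ℂ x (heckeFamilyOf hQ S hS k hD hDm inst δ y) := by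
  have hself : heckeFamilyOf hQ S hS k hD hDm inst δ = heckeFamilyOf hQ S hS k hD hDm inst δ⁻¹ :=
    heckeFamilyOf_eq_inv_of_inv_mem_doubleCoset hQ S hS k hD hDm inst
      (inv_mem_doubleCoset_of_sq_mem (by rw [hδ]; exact S.one_mem))
  have h := isFormalAdjointPair_heckeFamilyOf hQ S hS k hD hDm inst δ x y
  rw [← hself] at h
  exact h

/-- The sign component of a FORM: `P_ε f = ¼ (f + ε₀ T_{δ₀} f + ε₁ T_{δ₁} f + ε₀ε₁ T_{δ₀} T_{δ₁} f)`. -/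
noncomputable def projForm (δ₀ δ₁ : unitaryGroup K H) (ε₀ ε₁ : ℂ) (f : PeterssonForms hQ S hS k hD) :
    PeterssonForms hQ S hS k hD :=
  (4 : ℂ)⁻¹ • (f + ε₀ • @heckeForms _ _ _ _ _ _ _ hQ S hS _ _ k hD _ δ₀.2 (inst δ₀) f +
    ε₁ • @heckeForms _ _ _ _ _ _ _ hQ S hS _ _ k hD _ δ₁.2 (inst δ₁) f +
    (ε₀ * ε₁) • @heckeForms _ _ _ _ _ _ _ hQ S hS _ _ k hD _ δ₀.2 (inst δ₀)
      (@heckeForms _ _ _ _ _ _ _ hQ S hS _ _ k hD _ δ₁.2 (inst δ₁) f))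

/-- The class of the sign component of a form is the sign component (row 170's `proj`) of its class. -/
theorem mk_projForm (δ₀ δ₁ : unitaryGroup K H) (ε₀ ε₁ : ℂ) (f : PeterssonForms hQ S hS k hD) :
    SeparationQuotient.mk (projForm hQ S hS k hD inst δ₀ δ₁ ε₀ ε₁ f) =
      proj (heckeFamilyOf hQ S hS k hD hDm inst δ₀) (heckeFamilyOf hQ S hS k hD hDm inst δ₁) ε₀ ε₁
        (SeparationQuotient.mk f) := by
  simp only [projForm, proj, SeparationQuotient.mk_smul, SeparationQuotient.mk_add,
    heckeFamilyOf_mk hQ S hS k hD hDm inst]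

/-- THE SIGN SELECTION RULE FOR THE (N)-PERIOD. For two involutions `δ₀, δ₁ ∈ U(H)(K)` and a form `g` whose class
has signs `(ε₀, ε₁) ∈ {±1}²`: `∫_D ω_f ∧ conj ω_g = ∫_D ω_{P_ε f} ∧ conj ω_g` for EVERY weight-3 form
`f` — only the same-sign component of `f` pairs with `g`. -/
theorem setIntegral_hodgeWedge_eq_projForm_of_signs (hD3 : IsBallFundamentalDomain hQ S hS D)
    {δ₀ δ₁ : unitaryGroup K H} (h0 : (δ₀ : GL (Fin 3) K) * δ₀ = 1) (h1 : (δ₁ : GL (Fin 3) K) * δ₁ = 1)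
    {g : PeterssonForms hQ S hS 3 hD3} {ε₀ ε₁ : ℂ} (hε0 : ε₀ = 1 ∨ ε₀ = -1) (hε1 : ε₁ = 1 ∨ ε₁ = -1)
    (hg0 : heckeFamilyOf hQ S hS 3 hD3 hDm inst δ₀ (SeparationQuotient.mk g) = ε₀ • SeparationQuotient.mk g)
    (hg1 : heckeFamilyOf hQ S hS 3 hD3 hDm inst δ₁ (SeparationQuotient.mk g) = ε₁ • SeparationQuotient.mk g)
    (f : PeterssonForms hQ S hS 3 hD3) :
    ∫ x in (Subtype.val '' D),
        hodgeWedge (PeterssonForms.toForm hQ S hS 3 hD3 f : (Fin 2 → ℂ) → ℂ)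
          (PeterssonForms.toForm hQ S hS 3 hD3 g : (Fin 2 → ℂ) → ℂ) x =
      ∫ x in (Subtype.val '' D),
        hodgeWedge (PeterssonForms.toForm hQ S hS 3 hD3 (projForm hQ S hS 3 hD3 inst δ₀ δ₁ ε₀ ε₁ f) :
          (Fin 2 → ℂ) → ℂ) (PeterssonForms.toForm hQ S hS 3 hD3 g : (Fin 2 → ℂ) → ℂ) x := by
  rw [setIntegral_hodgeWedge_eq_inner_mk hQ S hS hD3 hDm, setIntegral_hodgeWedge_eq_inner_mk hQ S hS hD3 hDm,
    mk_projForm hQ S hS 3 hD3 hDm inst,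
    inner_proj_eq_of_signs (inner_heckeFamilyOf_eq_of_mul_self_eq_one hQ S hS 3 hD3 hDm inst h0)
      (inner_heckeFamilyOf_eq_of_mul_self_eq_one hQ S hS 3 hD3 hDm inst h1) hε0 hε1 hg0 hg1]

end General

end Summit.Ventures.HodgeRepro2.ShimuraData
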